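import Summits.Ventures.PercRepro.ProfileGapMonoColoopBand

/-!
# PercRepro — THE COLOOP BAND MODULO THE BRACKET (p5, gen 22; `proofs/P5-GM1.md` §18 EXHAUSTIVE; announced INBOX 10557)

`BracketQ N q u` is a two-level inequality between the rank-`(q−1)` sets of `N` whose complement has rank `≥ u + 1`
(weighted by `C(m', u−q)`) and the rank-`(q+1)` sets at the level `u − 1` (weighted by the demand), with the weights
of the free matroid `(u−q)(u−q−1)` against `(q+1)q`.  It is a CONJECTURE (exhaustively true on every matroid on
`≤ 9` elements: 0 violations on 3,081,544 tests, p5's C census on the engine catalogues) and is NOT asserted here.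
With the row `(q + 1, u − 1)` of `M ∖ z` it gives `(★_q)` in the coloop band for `q + 2 ≤ u` (`starQ_iff_band` +
`(q+1)·q·C(u−1, q+1) = (u−q)·(u−q−1)·C(u−1, q−1)`), hence `(GM)_q` at such a coloop from two rows of `M ∖ z`.

* `BracketQ` (a conjecture, not asserted), `choose_bracket_identity`, **`starQ_of_bracket_of_row`**,
  **`gapMonoQ_of_coloop_band`**.
-/

open scoped Matroid

namespace PercRepro.Cogirth

open Finset ThmH Skew Shadow Profile

variable {α : Type} [DecidableEq α] {M : Matroid α} [M.Finite]

section Bracket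

variable {N : Matroid α} [N.Finite] {q u : ℕ}

/-- **THE BRACKET** (a CONJECTURE, data only — exhaustively true on every matroid on `≤ 8` elements, 12,968 tests;
NOT asserted here): a two-level inequality between the rank-`(q−1)` sets whose complement has rank `≥ u + 1`,
weighted by `C(m', u−q)`, and the rank-`(q+1)` sets at the level `u − 1`, with the weights of the free matroid
`(u−q)(u−q−1)` against `(q+1)q`. -/
def BracketQ (N : Matroid α) [N.Finite] (q u : ℕ) : Prop :=
  (u - q) * (u - q - 1) *
      ∑ B' ∈ Rq N (q - 1),
        (if u + 1 ≤ rk N (gr N \ B') then (rk N (gr N \ B')).choose (u - q) else 0) ≤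
    (q + 1) * q * ∑ B'' ∈ Rq N (q + 1), demand N (q + 1) (u - 1) B''

/-- `(q+1)·q·C(u−1, q+1) = (u−q)·(u−q−1)·C(u−1, q−1)` for `1 ≤ q`, `q + 2 ≤ u`. -/
theorem choose_bracket_identity (hq : 1 ≤ q) (hqu : q + 2 ≤ u) :
    (q + 1) * q * (u - 1).choose (q + 1) = (u - q) * (u - q - 1) * (u - 1).choose (q - 1) := by
  obtain ⟨q', rfl⟩ : ∃ q', q = q' + 1 := ⟨q - 1, by omega⟩
  obtain ⟨v, rfl⟩ : ∃ v, u = v + q' + 3 := ⟨u - q' - 3, by omega⟩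
  simp only [Nat.add_sub_cancel]
  have h1 : v + q' + 3 - 1 = v + q' + 2 := by omega
  have h2 : v + q' + 3 - (q' + 1) = v + 2 := by omega
  have h3 : v + 2 - 1 = v + 1 := by omega
  rw [h1, h2, h3]
  show (q' + 2) * (q' + 1) * (v + q' + 2).choose (q' + 2) = (v + 2) * (v + 1) * (v + q' + 2).choose q'
  -- `C(v+q'+2, q'+2)·(q'+2)(q'+1) = C(v+q'+2, q')·(v+2)(v+1)`: both are `(v+q'+2)! / (q'! v!)`
  have ha := Nat.choose_mul_factorial_mul_factorial (show q' + 2 ≤ v + q' + 2 by omega)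
  have hb := Nat.choose_mul_factorial_mul_factorial (show q' ≤ v + q' + 2 by omega)
  have hc : v + q' + 2 - (q' + 2) = v := by omega
  have hd : v + q' + 2 - q' = v + 2 := by omega
  rw [hc] at ha
  rw [hd] at hb
  have hf1 : (q' + 2).factorial = (q' + 2) * (q' + 1) * q'.factorial := by
    rw [Nat.factorial_succ, Nat.factorial_succ]; ring
  have hf2 : (v + 2).factorial = (v + 2) * (v + 1) * v.factorial := by
    rw [Nat.factorial_succ, Nat.factorial_succ]; ring
  rw [hf1] at ha
  rw [hf2] at hb
  have hpos : 0 < q'.factorial * v.factorial := Nat.mul_pos (Nat.factorial_pos _) (Nat.factorial_pos _)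
  have key : ((q' + 2) * (q' + 1) * (v + q' + 2).choose (q' + 2)) * (q'.factorial * v.factorial) =
      ((v + 2) * (v + 1) * (v + q' + 2).choose q') * (q'.factorial * v.factorial) := by
    calc ((q' + 2) * (q' + 1) * (v + q' + 2).choose (q' + 2)) * (q'.factorial * v.factorial)
        = (v + q' + 2).choose (q' + 2) * ((q' + 2) * (q' + 1) * q'.factorial) * v.factorial := by ring
      _ = (v + q' + 2).factorial := ha
      _ = (v + q' + 2).choose q' * q'.factorial * ((v + 2) * (v + 1) * v.factorial) := hb.symm
      _ = ((v + 2) * (v + 1) * (v + q' + 2).choose q') * (q'.factorial * v.factorial) := by ring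
  have := Nat.eq_of_mul_eq_mul_right hpos key
  linarith

end Bracket

section Coloop2

variable {z : α} {q u : ℕ}

/-- **`(★_q)` in the band from the bracket and the row `(q + 1, u − 1)` of `M ∖ z`** (`q + 2 ≤ u`): the bracket
bounds the band form's left side by `(q+1)q/((u−q)(u−q−1))` times the row's demand, and the row bounds that
by the co-rank-`(q+1)` count. -/
theorem starQ_of_bracket_of_row (hq : 1 ≤ q) (hqu : q + 2 ≤ u) (hb : BracketQ (M ＼ ({z} : Set α)) q u)
    (h : ProfileIneqMinusQ (M ＼ ({z} : Set α)) (q + 1) (u - 1)) : StarQ M z q u := by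
  rw [starQ_iff_band (by omega)]
  unfold BracketQ at hb
  unfold ProfileIneqMinusQ at h
  have hid := choose_bracket_identity hq hqu
  have hpos : 0 < (u - q) * (u - q - 1) := Nat.mul_pos (by omega) (by omega)
  -- (u−q)(u−q−1)·T ≤ (q+1)q·L ≤ (q+1)q·C(u−1,q+1)·W = (u−q)(u−q−1)·C(u−1,q−1)·W
  have h2 : (q + 1) * q * ∑ B'' ∈ Rq (M ＼ ({z} : Set α)) (q + 1), demand (M ＼ ({z} : Set α)) (q + 1) (u - 1) B'' ≤
      (u - q) * (u - q - 1) * ((u - 1).choose (q - 1) *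
        (levelSetCoQ (M ＼ ({z} : Set α)) (q + 1) (u - 1)).card) := by
    calc (q + 1) * q * ∑ B'' ∈ Rq (M ＼ ({z} : Set α)) (q + 1), demand (M ＼ ({z} : Set α)) (q + 1) (u - 1) B''
        ≤ (q + 1) * q * ((u - 1).choose (q + 1) * (levelSetCoQ (M ＼ ({z} : Set α)) (q + 1) (u - 1)).card) :=
          Nat.mul_le_mul_left _ h
      _ = (q + 1) * q * (u - 1).choose (q + 1) * (levelSetCoQ (M ＼ ({z} : Set α)) (q + 1) (u - 1)).card := by ring
      _ = (u - q) * (u - q - 1) * (u - 1).choose (q - 1) *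
            (levelSetCoQ (M ＼ ({z} : Set α)) (q + 1) (u - 1)).card := by rw [hid]
      _ = _ := by ring
  exact Nat.le_of_mul_le_mul_left (hb.trans h2) hpos

/-- **`(GM)_q` at a coloop in the band, modulo the bracket** (`q + 2 ≤ u`): from the rows `(q, u−1)` and
`(q+1, u−1)` of `M ∖ z` and `BracketQ (M ∖ z) q u`. -/
theorem gapMonoQ_of_coloop_band (hz : z ∈ gr M) (hzc : rk M ((gr M).erase z) + 1 = rk M (gr M))
    (hq : 1 ≤ q) (hqu : q + 2 ≤ u) (hb : BracketQ (M ＼ ({z} : Set α)) q u)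
    (h1 : ProfileIneqMinusQ (M ＼ ({z} : Set α)) q (u - 1))
    (h2 : ProfileIneqMinusQ (M ＼ ({z} : Set α)) (q + 1) (u - 1)) : GapMonoQ M z q u :=
  gapMonoQ_of_coloop_of_starQ hz hzc hq (by omega) h1 (starQ_of_bracket_of_row hq hqu hb h2)

end Coloop2

end PercRepro.Cogirth
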